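import Literature.Topology.FourManifolds.InteriorTangent
import Literature.Topology.FourManifolds.MorseChartChangeInterior
import Literature.Topology.FourManifolds.Recharted
import Literature.Topology.FourManifolds.ThickenedPlanarHandlebody
import Literature.Topology.FourManifolds.RegularLevelSplitting
import HarnessLib

/-!
# The thickening `{f(w) + s² ≤ c}` of a sublevel set: a compact manifold with boundary one
# dimension up, with the handle counts of `f`

Topic `Literature/Topology/FourManifolds` (fact seat
`provefact-Literature.Topology.FourManifolds.Mazur1-7c05d98c84`, Mazur 1961 / Aitchison–Rubinstein
1984 Lemma 5.4, `MazurDouble.lean`, which descends to the named fact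
`Literature.Topology.FourManifolds.exists_thickening_of_isDouble` of `DoubleThickening.lean`:
*the double of a compact manifold with boundary `W` bounds the thickening `W × [0, 1]`, a
handlebody with handles of the same indices*).  This file is the Morse-theoretic half of that
thickening, with **handle counts** (the printed sources: Freedman–Gompf–Morrison–Walker 2010,
proof of Fact 2, *"The handle structure on `B'` stabilizes to a handle structure on `B' × I`
also with `k` 1-handles and `k` 2-handles"*; Kirby 1989, Ch. I §2; the Morse reading is Milnor,
*Morse theory* (1963), §2: the Hessian of `f(w) + s²` at `(w, 0)` is `Hess f_w ⊕ (2)`, same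
index, and §3, Thms. 3.1–3.2: regular sublevel sets and their handles).  Everything here is
**proved**; no named facts are introduced.

## Construction

For a manifold with boundary `W` (model `𝓡∂ (n + 1)`) the product `W × ℝ` is a manifold with
boundary for the product model `(𝓡∂ (n + 1)).prod 𝓘(ℝ, ℝ)`; its interior `Int W × ℝ`
(Mathlib `ModelWithCorners.interior_prod`) is a manifold *without* boundary modelled on the
vector space `ℝⁿ⁺¹ × ℝ` (the tree's `InteriorManifold`), which we rechart on `ℝⁿ⁺²` along a
linear isomorphism `L : ℝⁿ⁺¹ × ℝ ≃L ℝⁿ⁺²` (the tree's `Recharted`) so that the regular-sublevel-set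
machinery of `RegularLevelSplitting.lean` (stated over `ℝᵏ⁺¹`-charted ambients) applies:

* `DoubleThickening.Ambient W L` — the boundaryless `(n+2)`-manifold `Int W × ℝ` charted on
  `ℝⁿ⁺²`; `DoubleThickening.pt : Ambient W L → W × ℝ` its (injective, smooth) structure map;
* `DoubleThickening.thickFun L f (w, s) = f w + s²` — the thickened function;
* **Morse data** (§3): `x = (w, s)` is critical for `f + s²` iff `w` is critical for `f` and
  `s = 0` (`isMCriticalPt_thickFun_iff`); the Hessian is `Hess f_w ((L⁻¹v)₁, (L⁻¹v')₁) +
  2 (L⁻¹v)₂ (L⁻¹v')₂` (`mhessian_thickFun_apply`), nondegenerate when `Hess f_w` is, with the same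
  negative index of inertia (`morseIndex_thickFun`, by the tree's signature lemma
  `sigNeg_eq_of_proj`); so `f + s²` is a Morse function when `f` is (`isMorse_thickFun`), and a
  level `c` which is not a critical value of `f` is a regular level (`isRegularLevel_thickFun`);
* **the thickening** (§4) `DoubleThickening.Thickening L hf hc = {f + s² ≤ c}`
  (`RegularSublevel`): a `C^∞` manifold with boundary `{f + s² = c}` modelled on `𝓡∂ (n + 2)`,
  Hausdorff and second countable with `W`, **compact** when `W` is compact and `{f ≤ c}` lies in
  the interior (`Thickening.compactSpace`: `{f + s² ≤ c} ⊆ {f ≤ c} × [-R, R]`), with a **handle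
  decomposition with exactly as many handles of index `i` as `f` has critical points of index `i`
  below `c`** (`Thickening.hasHandleDecomposition`) — in particular a `k`-handlebody when these
  critical points have index `≤ k` (`Thickening.isHandlebodyOfIndexLE`).

The computations of §3 are read in the charts of `W` at interior points, where the tree's
`mhessian` is the plain second Fréchet derivative of the function written in the chart
(`MorseChartChangeInterior.lean`); the model calculus is that of `ψ(u, t) = φ(u) + t²` on
`E × ℝ` (§1), as in `ThickenedHandlebodyFive.lean` for `ℝ⁴ × ℝ`.

## Not here

The identification of the boundary `{f + s² = c}` with the double of `W`, and the homotopy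
equivalence `{f + s² ≤ c} ≃ₕ W` (flow-out of `∂W`, `BoundaryFlowout.lean`), which complete the
discharge of `exists_thickening_of_isDouble`; they are the business of the sibling proofs file.

## References

* M. Freedman, R. Gompf, S. Morrison, K. Walker, *Man and machine thinking about the smooth
  4-dimensional Poincaré conjecture*, Quantum Topol. 1 (2010), proof of Fact 2.
  [FreedmanGompfMorrisonWalker2010]
* R. C. Kirby, *The topology of 4-manifolds*, LNM 1374 (1989), Ch. I §2 and p. 18. [Kirby1989]
* J. Milnor, *Morse theory*, Ann. of Math. Studies 51 (1963), §2, §3 (Thms. 3.1–3.2). [Milnor1963]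
* B. Mazur, *A note on some contractible 4-manifolds*, Ann. of Math. 73 (1961), 221–228 (`W × I`).
  [Mazur1961]
-/

open scoped Manifold ContDiff Topology
open Set Function Filter

noncomputable section

namespace Literature.Topology.FourManifolds

universe u

/-- Local notation: `𝔼 n` is the model Euclidean space `EuclideanSpace ℝ (Fin n)`. -/
local notation "𝔼 " n:arg => EuclideanSpace ℝ (Fin n)

namespace DoubleThickening

variable {n : ℕ} {W : Type u} [TopologicalSpace W] [ChartedSpace (EuclideanHalfSpace (n + 1)) W]

/-- The product corners model of `W × ℝ`. [folklore] -/
abbrev prodModel (n : ℕ) : ModelWithCorners ℝ (𝔼 (n + 1) × ℝ) (ModelProd (EuclideanHalfSpace (n + 1)) ℝ) :=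
  (𝓡∂ (n + 1)).prod 𝓘(ℝ, ℝ)

/-- The boundaryless `(n+2)`-manifold `Int(W × ℝ) = Int W × ℝ`, recharted on `ℝⁿ⁺²` along `L`. [folklore] -/
abbrev Ambient (W : Type u) [TopologicalSpace W] [ChartedSpace (EuclideanHalfSpace (n + 1)) W]
    (L : (𝔼 (n + 1) × ℝ) ≃L[ℝ] 𝔼 (n + 1 + 1)) : Type u :=
  Recharted (InteriorManifold (prodModel n) (W × ℝ)) L

variable (L : (𝔼 (n + 1) × ℝ) ≃L[ℝ] 𝔼 (n + 1 + 1))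

/-- The underlying point of `W × ℝ`. [folklore] -/
def pt (x : Ambient W L) : W × ℝ := ((Recharted.of L).symm x).val

/-- Points of the ambient are interior points of `W × ℝ`. [folklore] -/
theorem isInteriorPoint_pt (x : Ambient W L) : (prodModel n).IsInteriorPoint (pt L x) :=
  ((Recharted.of L).symm x).property

/-- The structure map `pt` is injective. [folklore] -/
theorem injective_pt : Injective (pt L : Ambient W L → W × ℝ) := fun _ _ h =>
  (Recharted.of L).symm.injective (InteriorManifold.val_injective h)

/-- The thickened function `G(w, s) = f w + s²`. [cite: Milnor1963, §2] -/
def thickFun (f : W → ℝ) (x : Ambient W L) : ℝ := f (pt L x).1 + (pt L x).2 ^ 2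

variable [IsManifold (𝓡∂ (n + 1)) ∞ W]

/-- The structure map `pt : Int W × ℝ → W × ℝ` is `C^∞` (inclusion of the interior after the
recharting identity). [folklore] -/
theorem contMDiff_pt : ContMDiff (𝓡 (n + 1 + 1)) (prodModel n) ∞ (pt L : Ambient W L → W × ℝ) :=
  InteriorManifold.contMDiff_val.comp (Recharted.contMDiff_of_symm L)

/-- The thickened function `f + s²` is `C^∞` on the ambient when `f` is `C^∞`. [folklore] -/
theorem contMDiff_thickFun {f : W → ℝ} (hf : ContMDiff (𝓡∂ (n + 1)) 𝓘(ℝ, ℝ) ∞ f) :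
    ContMDiff (𝓡 (n + 1 + 1)) 𝓘(ℝ, ℝ) ∞ (thickFun L f) := by
  have h1 : ContMDiff (𝓡 (n + 1 + 1)) (𝓡∂ (n + 1)) ∞ fun x : Ambient W L => (pt L x).1 :=
    contMDiff_fst.comp (contMDiff_pt L)
  have h2 : ContMDiff (𝓡 (n + 1 + 1)) 𝓘(ℝ, ℝ) ∞ fun x : Ambient W L => (pt L x).2 :=
    contMDiff_snd.comp (contMDiff_pt L)
  exact (hf.comp h1).add (h2.pow 2)

/-- The model function `ψ(u, t) = f̂(u) + t²` read in the chart of `W` at `w`. [folklore] -/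
def modelFun (f : W → ℝ) (w : W) (q : 𝔼 (n + 1) × ℝ) : ℝ :=
  writtenInExtChartAt (𝓡∂ (n + 1)) 𝓘(ℝ, ℝ) w f q.1 + q.2 ^ 2

omit [IsManifold (𝓡∂ (n + 1)) ∞ W] in
/-- Unfolding lemma for `modelFun`. [folklore] -/
theorem modelFun_def (f : W → ℝ) (w : W) :
    modelFun f w = fun q : 𝔼 (n + 1) × ℝ => writtenInExtChartAt (𝓡∂ (n + 1)) 𝓘(ℝ, ℝ) w f q.1 + q.2 ^ 2 :=
  rfl

/-- The extended chart of the ambient at `x` is `L ∘ (φ_w × id)` through `pt` (the product chart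
of `W × ℝ` at `pt x`, Mathlib `extChartAt_prod`). [folklore] -/
theorem extChartAt_apply' (x : Ambient W L) (y : Ambient W L) :
    extChartAt 𝓘(ℝ, 𝔼 (n + 1 + 1)) x y = L (extChartAt (prodModel n) (pt L x) (pt L y)) := by
  rw [Recharted.extChartAt_coe]
  simp only [Function.comp_apply]
  congr 1

/-- Near the chart image of `x`, `G` read in the extended chart of the ambient at `x` is
`ψ ∘ L⁻¹`. [folklore] -/
theorem writtenInExtChartAt_thickFun_eventuallyEq (f : W → ℝ) (x : Ambient W L) :
    writtenInExtChartAt 𝓘(ℝ, 𝔼 (n + 1 + 1)) 𝓘(ℝ, ℝ) x (thickFun L f) =ᶠ[𝓝 (extChartAt 𝓘(ℝ, 𝔼 (n + 1 + 1)) x x)]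
      fun u => modelFun f (pt L x).1 (L.symm u) := by
  filter_upwards [extChartAt_target_mem_nhds (I := 𝓘(ℝ, 𝔼 (n + 1 + 1))) x] with u hu
  simp only [writtenInExtChartAt, thickFun, modelFun, pt, Function.comp_apply]
  rw [Recharted.extChartAt_symm_coe]
  simp only [Function.comp_apply, Recharted.of_symm_apply_of]
  have hu' : L.symm u ∈ (extChartAt 𝓘(ℝ, 𝔼 (n + 1) × ℝ) ((Recharted.of L).symm x)).target := by
    rw [Recharted.extChartAt_target'] at hu
    simpa [extChartAt] using hu
  have key := InteriorManifold.extChartAt_symm_apply_val ((Recharted.of L).symm x) hu'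
  have hc : (chartAt (𝔼 (n + 1) × ℝ) ((Recharted.of L).symm x)).symm (L.symm u) =
      (extChartAt 𝓘(ℝ, 𝔼 (n + 1) × ℝ) ((Recharted.of L).symm x)).symm (L.symm u) := by
    simp [extChartAt]
  rw [hc, key, extChartAt_prod]
  simp [PartialEquiv.prod_symm]

/-! ### Calculus of `ψ(u, t) = φ(u) + t²` on `E × ℝ` -/

section Calculus

variable {E : Type*} [NormedAddCommGroup E] [NormedSpace ℝ E]

/-- The vertical coordinate `(u, t) ↦ t` as a continuous linear map. [folklore] -/
abbrev sndL (E : Type*) [NormedAddCommGroup E] [NormedSpace ℝ E] : (E × ℝ) →L[ℝ] ℝ :=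
  ContinuousLinearMap.snd ℝ E ℝ

/-- First derivative of `ψ(u, t) = φ(u) + t²`. [folklore] -/
theorem hasFDerivAt_modelSum {φ : E → ℝ} {φ' : E →L[ℝ] ℝ} {q : E × ℝ}
    (hφ : HasFDerivAt φ φ' q.1) :
    HasFDerivAt (fun q : E × ℝ => φ q.1 + q.2 ^ 2)
      (φ'.comp (ContinuousLinearMap.fst ℝ E ℝ) + (2 * q.2) • sndL E) q := by
  have h1 : HasFDerivAt (fun q : E × ℝ => φ q.1) (φ'.comp (ContinuousLinearMap.fst ℝ E ℝ)) q :=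
    hφ.comp q hasFDerivAt_fst
  have h0 : HasDerivAt (fun t : ℝ => t ^ 2) (2 * q.2) q.2 := by simpa using hasDerivAt_pow 2 q.2
  have h2 : HasFDerivAt (fun q : E × ℝ => q.2 ^ 2) ((2 * q.2) • sndL E) q :=
    h0.comp_hasFDerivAt q hasFDerivAt_snd
  exact h1.add h2

/-- `dψ_{(u,t)} = dφ_u ∘ pr₁ + 2t dt`. [folklore] -/
theorem fderiv_modelSum {φ : E → ℝ} {q : E × ℝ} (hφ : DifferentiableAt ℝ φ q.1) :
    fderiv ℝ (fun q : E × ℝ => φ q.1 + q.2 ^ 2) q =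
      (fderiv ℝ φ q.1).comp (ContinuousLinearMap.fst ℝ E ℝ) + (2 * q.2) • sndL E :=
  (hasFDerivAt_modelSum hφ.hasFDerivAt).fderiv

/-- `dψ_{(u,t)} = 0 ↔ dφ_u = 0 ∧ t = 0`. [folklore] -/
theorem fderiv_modelSum_eq_zero_iff {φ : E → ℝ} {q : E × ℝ} (hφ : DifferentiableAt ℝ φ q.1) :
    fderiv ℝ (fun q : E × ℝ => φ q.1 + q.2 ^ 2) q = 0 ↔ fderiv ℝ φ q.1 = 0 ∧ q.2 = 0 := by
  rw [fderiv_modelSum hφ]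
  constructor
  · intro h
    have ht : q.2 = 0 := by
      have h1 := congrArg (fun T : (E × ℝ) →L[ℝ] ℝ => T (0, 1)) h
      simp [sndL] at h1
      exact h1
    refine ⟨?_, ht⟩
    ext v
    have h1 := congrArg (fun T : (E × ℝ) →L[ℝ] ℝ => T (v, 0)) h
    simpa using h1
  · rintro ⟨h1, h2⟩
    rw [h1, h2]; simp

/-- Second derivative of `ψ`: `d²ψ_q (v, v') = d²φ_{q.1} (v.1, v'.1) + 2 v.2 v'.2`, for `φ` of
class `C²` near `q.1`. [folklore] -/
theorem fderiv_fderiv_modelSum_apply {φ : E → ℝ} {q : E × ℝ} (hφ : ContDiffAt ℝ 2 φ q.1)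
    (v v' : E × ℝ) :
    fderiv ℝ (fderiv ℝ (fun q : E × ℝ => φ q.1 + q.2 ^ 2)) q v v' =
      fderiv ℝ (fderiv ℝ φ) q.1 v.1 v'.1 + 2 * v.2 * v'.2 := by
  -- `fderiv ψ` near `q` is `q' ↦ (fderiv φ q'.1).comp fst + (2 q'.2) • snd`
  have hd : ∀ᶠ q' in 𝓝 q, DifferentiableAt ℝ φ q'.1 := by
    have h1 : ∀ᶠ u in 𝓝 q.1, DifferentiableAt ℝ φ u :=
      (hφ.eventually (by simp)).mono fun u hu => hu.differentiableAt (by simp)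
    exact continuousAt_fst.eventually h1
  have hev : fderiv ℝ (fun q : E × ℝ => φ q.1 + q.2 ^ 2) =ᶠ[𝓝 q]
      fun q' => (fderiv ℝ φ q'.1).comp (ContinuousLinearMap.fst ℝ E ℝ) + (2 * q'.2) • sndL E :=
    hd.mono fun q' hq' => fderiv_modelSum hq'
  rw [hev.fderiv_eq]
  have hφ2 : DifferentiableAt ℝ (fderiv ℝ φ) q.1 :=
    (hφ.fderiv_right (m := 1) le_rfl).differentiableAt one_ne_zero
  have hA : HasFDerivAt (fun q' : E × ℝ => (fderiv ℝ φ q'.1).comp (ContinuousLinearMap.fst ℝ E ℝ))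
      ((ContinuousLinearMap.precomp ℝ (ContinuousLinearMap.fst ℝ E ℝ)).comp
        ((fderiv ℝ (fderiv ℝ φ) q.1).comp (ContinuousLinearMap.fst ℝ E ℝ))) q := by
    have hc : HasFDerivAt (fun q' : E × ℝ => fderiv ℝ φ q'.1)
        ((fderiv ℝ (fderiv ℝ φ) q.1).comp (ContinuousLinearMap.fst ℝ E ℝ)) q :=
      hφ2.hasFDerivAt.comp q hasFDerivAt_fst
    exact (ContinuousLinearMap.precomp ℝ (ContinuousLinearMap.fst ℝ E ℝ)).hasFDerivAt.comp q hc
  have hs : HasFDerivAt (fun q' : E × ℝ => 2 * q'.2) ((2 : ℝ) • sndL E) q := by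
    have := (hasFDerivAt_snd (𝕜 := ℝ) (E := E) (F := ℝ) (p := q)).const_mul (2 : ℝ)
    simpa using this
  have hB : HasFDerivAt (fun q' : E × ℝ => (2 * q'.2) • sndL E)
      (((2 : ℝ) • sndL E).smulRight (sndL E)) q := hs.smul_const (sndL E)
  have hsum : HasFDerivAt
      (fun q' : E × ℝ => (fderiv ℝ φ q'.1).comp (ContinuousLinearMap.fst ℝ E ℝ) + (2 * q'.2) • sndL E)
      ((ContinuousLinearMap.precomp ℝ (ContinuousLinearMap.fst ℝ E ℝ)).comp
        ((fderiv ℝ (fderiv ℝ φ) q.1).comp (ContinuousLinearMap.fst ℝ E ℝ)) +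
        ((2 : ℝ) • sndL E).smulRight (sndL E)) q := hA.add hB
  rw [hsum.fderiv]
  simp [ContinuousLinearMap.smulRight_apply, ContinuousLinearMap.precomp]

/-- Second derivative of a function precomposed with a linear isomorphism:
`d²(ψ ∘ A)_u (v, v') = d²ψ_{A u} (A v, A v')`. [folklore] -/
theorem fderiv_fderiv_comp_continuousLinearEquiv_apply {E' : Type*} [NormedAddCommGroup E']
    [NormedSpace ℝ E'] {F : Type*} [NormedAddCommGroup F] [NormedSpace ℝ F]
    (A : E' ≃L[ℝ] F) {ψ : F → ℝ} {u : E'}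
    (hψ : ContDiffAt ℝ 2 ψ (A u)) (v v' : E') :
    fderiv ℝ (fderiv ℝ (ψ ∘ A)) u v v' = fderiv ℝ (fderiv ℝ ψ) (A u) (A v) (A v') := by
  have h1 : fderiv ℝ (ψ ∘ A) = fun u' => (fderiv ℝ ψ (A u')).comp (A : E' →L[ℝ] F) := by
    funext u'
    exact A.comp_right_fderiv
  rw [h1]
  have hψ2 : DifferentiableAt ℝ (fderiv ℝ ψ) (A u) :=
    (hψ.fderiv_right (m := 1) le_rfl).differentiableAt one_ne_zero
  have hc : HasFDerivAt (fun u' : E' => fderiv ℝ ψ (A u'))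
      ((fderiv ℝ (fderiv ℝ ψ) (A u)).comp (A : E' →L[ℝ] F)) u :=
    hψ2.hasFDerivAt.comp u (A : E' →L[ℝ] F).hasFDerivAt
  have hP : HasFDerivAt (fun T : F →L[ℝ] ℝ => T.comp (A : E' →L[ℝ] F))
      (ContinuousLinearMap.precomp ℝ (A : E' →L[ℝ] F)) (fderiv ℝ ψ (A u)) :=
    (ContinuousLinearMap.precomp ℝ (A : E' →L[ℝ] F)).hasFDerivAt
  have h2 := hP.comp u hc
  rw [show (fun u' : E' => (fderiv ℝ ψ (A u')).comp (A : E' →L[ℝ] F)) =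
      (fun T : F →L[ℝ] ℝ => T.comp (A : E' →L[ℝ] F)) ∘ (fun u' : E' => fderiv ℝ ψ (A u')) from rfl,
    h2.fderiv]
  simp only [ContinuousLinearMap.comp_apply, ContinuousLinearMap.precomp_apply,
    ContinuousLinearEquiv.coe_coe]

/-- First derivative of a function precomposed with a linear isomorphism vanishes iff the
derivative of the function vanishes at the image point. [folklore] -/
theorem fderiv_comp_continuousLinearEquiv_eq_zero_iff {E' : Type*} [NormedAddCommGroup E']
    [NormedSpace ℝ E'] {F : Type*} [NormedAddCommGroup F] [NormedSpace ℝ F]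
    (A : E' ≃L[ℝ] F) (ψ : F → ℝ) (u : E') :
    fderiv ℝ (ψ ∘ A) u = 0 ↔ fderiv ℝ ψ (A u) = 0 := by
  rw [A.comp_right_fderiv]
  constructor
  · intro h
    have h2 : ((fderiv ℝ ψ (A u)).comp (A : E' →L[ℝ] F)).comp (A.symm : F →L[ℝ] E') = 0 := by
      rw [h, ContinuousLinearMap.zero_comp]
    simpa [ContinuousLinearMap.comp_assoc] using h2
  · intro h
    rw [h, ContinuousLinearMap.zero_comp]

end Calculus

/-! ### Morse data of the thickened function -/

section MorseData

variable {f : W → ℝ}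

omit [IsManifold (𝓡∂ (n + 1)) ∞ W] in
/-- The base point of a point of the ambient is an interior point of `W`. [folklore] -/
theorem isInteriorPoint_fst_pt (x : Ambient W L) : (𝓡∂ (n + 1)).IsInteriorPoint (pt L x).1 := by
  have h : pt L x ∈ (prodModel n).interior (W × ℝ) := isInteriorPoint_pt L x
  rw [ModelWithCorners.interior_prod] at h
  exact h.1

/-- The chart image of `x` in the ambient: `L (φ_w w, s)`. [folklore] -/
theorem extChartAt_self_apply (x : Ambient W L) :
    extChartAt 𝓘(ℝ, 𝔼 (n + 1 + 1)) x x =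
      L (extChartAt (𝓡∂ (n + 1)) (pt L x).1 (pt L x).1, (pt L x).2) := by
  rw [extChartAt_apply', extChartAt_prod]
  simp

/-- `f` read in the chart of `W` at the (interior) base point is `C²` at the chart image. [folklore] -/
theorem contDiffAt_writtenInExtChartAt_fst (hf : ContMDiff (𝓡∂ (n + 1)) 𝓘(ℝ, ℝ) ∞ f)
    (x : Ambient W L) :
    ContDiffAt ℝ 2 (writtenInExtChartAt (𝓡∂ (n + 1)) 𝓘(ℝ, ℝ) (pt L x).1 f)
      (extChartAt (𝓡∂ (n + 1)) (pt L x).1 (pt L x).1) := by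
  have h := contDiffAt_comp_extend_symm_of_isInteriorPoint (I := 𝓡∂ (n + 1)) (f := f)
    (x := (pt L x).1) (e := chartAt (EuclideanHalfSpace (n + 1)) (pt L x).1)
    ((hf.of_le (by norm_cast)).contMDiffAt) (IsManifold.chart_mem_maximalAtlas _)
    (mem_chart_source _ _) (isInteriorPoint_fst_pt L x)
  rwa [writtenInExtChartAt_eq_comp_extend_symm]

/-- **Critical points of the thickening**: `x = (w, s)` is critical for `G = f + s²` iff `w` is
critical for `f` and `s = 0`. [cite: Milnor1963, §2] -/
theorem isMCriticalPt_thickFun_iff (hf : ContMDiff (𝓡∂ (n + 1)) 𝓘(ℝ, ℝ) ∞ f) (x : Ambient W L) :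
    IsMCriticalPt (𝓡 (n + 1 + 1)) (thickFun L f) x ↔
      IsMCriticalPt (𝓡∂ (n + 1)) f (pt L x).1 ∧ (pt L x).2 = 0 := by
  have hG2 : ContMDiffAt (𝓡 (n + 1 + 1)) 𝓘(ℝ, ℝ) 2 (thickFun L f) x :=
    ((contMDiff_thickFun L hf).of_le (by norm_cast)).contMDiffAt
  have hx : (𝓡 (n + 1 + 1)).IsInteriorPoint x := BoundarylessManifold.isInteriorPoint
  rw [isMCriticalPt_iff_fderiv_comp_extend_symm_eq_zero_of_isInteriorPoint hG2
    (IsManifold.chart_mem_maximalAtlas _) (mem_chart_source _ _) hx,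
    ← writtenInExtChartAt_eq_comp_extend_symm]
  have hpt : (chartAt (𝔼 (n + 1 + 1)) x).extend (𝓡 (n + 1 + 1)) x = extChartAt 𝓘(ℝ, 𝔼 (n + 1 + 1)) x x := rfl
  rw [hpt, (writtenInExtChartAt_thickFun_eventuallyEq L f x).fderiv_eq]
  have hcomp : (fun u => modelFun f (pt L x).1 (L.symm u)) = modelFun f (pt L x).1 ∘ L.symm := rfl
  rw [hcomp, fderiv_comp_continuousLinearEquiv_eq_zero_iff, extChartAt_self_apply,
    ContinuousLinearEquiv.symm_apply_apply]
  have hφ : DifferentiableAt ℝ (writtenInExtChartAt (𝓡∂ (n + 1)) 𝓘(ℝ, ℝ) (pt L x).1 f)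
      (extChartAt (𝓡∂ (n + 1)) (pt L x).1 (pt L x).1) :=
    (contDiffAt_writtenInExtChartAt_fst L hf x).differentiableAt (by norm_num)
  rw [modelFun_def, fderiv_modelSum_eq_zero_iff hφ]
  have hf2 : ContMDiffAt (𝓡∂ (n + 1)) 𝓘(ℝ, ℝ) 2 f (pt L x).1 := ((hf.of_le (by norm_cast)).contMDiffAt)
  rw [isMCriticalPt_iff_fderiv_comp_extend_symm_eq_zero_of_isInteriorPoint hf2
    (IsManifold.chart_mem_maximalAtlas _) (mem_chart_source _ _) (isInteriorPoint_fst_pt L x),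
    ← writtenInExtChartAt_eq_comp_extend_symm]
  rfl

/-- **The Hessian of the thickening**: `Hess G_x (v, v') = Hess f_w ((L⁻¹v)₁, (L⁻¹v')₁) +
2 (L⁻¹v)₂ (L⁻¹v')₂`. [cite: Milnor1963, §2] -/
theorem mhessian_thickFun_apply (hf : ContMDiff (𝓡∂ (n + 1)) 𝓘(ℝ, ℝ) ∞ f) (x : Ambient W L)
    (v v' : 𝔼 (n + 1 + 1)) :
    mhessian (𝓡 (n + 1 + 1)) (thickFun L f) x v v' =
      mhessian (𝓡∂ (n + 1)) f (pt L x).1 (L.symm v).1 (L.symm v').1 +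
        2 * (L.symm v).2 * (L.symm v').2 := by
  have hx : (𝓡 (n + 1 + 1)).IsInteriorPoint x := BoundarylessManifold.isInteriorPoint
  rw [mhessian_apply_eq_fderiv_fderiv_of_isInteriorPoint' (I := 𝓡 (n + 1 + 1)) hx,
    ((writtenInExtChartAt_thickFun_eventuallyEq L f x).fderiv).fderiv_eq]
  have hcomp : (fun u => modelFun f (pt L x).1 (L.symm u)) = modelFun f (pt L x).1 ∘ L.symm := rfl
  have hφ := contDiffAt_writtenInExtChartAt_fst L hf x
  have hψ : ContDiffAt ℝ 2 (modelFun f (pt L x).1) (L.symm (extChartAt 𝓘(ℝ, 𝔼 (n + 1 + 1)) x x)) := by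
    rw [extChartAt_self_apply, ContinuousLinearEquiv.symm_apply_apply]
    rw [modelFun_def]
    exact (hφ.comp (extChartAt (𝓡∂ (n + 1)) (pt L x).1 (pt L x).1, (pt L x).2)
      (contDiffAt_fst (𝕜 := ℝ) (E := 𝔼 (n + 1)) (F := ℝ))).add
      ((contDiffAt_snd (𝕜 := ℝ) (E := 𝔼 (n + 1)) (F := ℝ)).pow 2)
  rw [hcomp, fderiv_fderiv_comp_continuousLinearEquiv_apply L.symm hψ, extChartAt_self_apply,
    ContinuousLinearEquiv.symm_apply_apply]
  rw [modelFun_def, fderiv_fderiv_modelSum_apply hφ,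
    mhessian_apply_eq_fderiv_fderiv_of_isInteriorPoint' (I := 𝓡∂ (n + 1)) (isInteriorPoint_fst_pt L x)]

/-- **Nondegeneracy transfers to the thickening.** [cite: Milnor1963, §2] -/
theorem nondegenerate_mhessian_thickFun (hf : ContMDiff (𝓡∂ (n + 1)) 𝓘(ℝ, ℝ) ∞ f) {x : Ambient W L}
    (h : (mhessian (𝓡∂ (n + 1)) f (pt L x).1).Nondegenerate) :
    (mhessian (𝓡 (n + 1 + 1)) (thickFun L f) x).Nondegenerate := by
  have key := mhessian_thickFun_apply L hf x
  -- the vertical vector and the lift of a base vector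
  have hvert : ∀ v : 𝔼 (n + 1 + 1), (∀ v', mhessian (𝓡 (n + 1 + 1)) (thickFun L f) x v v' = 0) →
      (L.symm v).2 = 0 ∧ (L.symm v).1 = 0 := by
    intro v hv
    have hz : (L.symm v).2 = 0 := by
      have h1 := hv (L ((0 : 𝔼 (n + 1)), (1 : ℝ)))
      rw [key] at h1
      simp only [ContinuousLinearEquiv.symm_apply_apply, map_zero, mul_one, zero_add] at h1
      linarith
    refine ⟨hz, h.1 _ fun u => ?_⟩
    have h1 := hv (L (u, 0))
    rw [key] at h1
    simpa [hz] using h1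
  have hvert' : ∀ v : 𝔼 (n + 1 + 1), (∀ v', mhessian (𝓡 (n + 1 + 1)) (thickFun L f) x v' v = 0) →
      (L.symm v).2 = 0 ∧ (L.symm v).1 = 0 := by
    intro v hv
    have hz : (L.symm v).2 = 0 := by
      have h1 := hv (L ((0 : 𝔼 (n + 1)), (1 : ℝ)))
      rw [key] at h1
      simp only [ContinuousLinearEquiv.symm_apply_apply, mul_one] at h1
      have h2 : mhessian (𝓡∂ (n + 1)) f (pt L x).1 (0 : 𝔼 (n + 1)) (L.symm v).1 = 0 := by
        simp
      linarith
    refine ⟨hz, h.2 _ fun u => ?_⟩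
    have h1 := hv (L (u, 0))
    rw [key] at h1
    simpa [hz] using h1
  have hrec : ∀ v : 𝔼 (n + 1 + 1), (L.symm v).2 = 0 → (L.symm v).1 = 0 → v = 0 := by
    intro v h2 h1
    have : L.symm v = 0 := Prod.ext h1 h2
    simpa using congrArg L this
  exact ⟨fun v hv => hrec v (hvert v hv).1 (hvert v hv).2,
    fun v hv => hrec v (hvert' v hv).1 (hvert' v hv).2⟩

/-- **The Morse index is unchanged by thickening.** [cite: Milnor1963, §2] -/
theorem morseIndex_thickFun (hf : ContMDiff (𝓡∂ (n + 1)) 𝓘(ℝ, ℝ) ∞ f) (x : Ambient W L) :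
    morseIndex (𝓡 (n + 1 + 1)) (thickFun L f) x = morseIndex (𝓡∂ (n + 1)) f (pt L x).1 := by
  unfold morseIndex
  have key := mhessian_thickFun_apply L hf x
  refine sigNeg_eq_of_proj _ _
    ((LinearMap.fst ℝ (𝔼 (n + 1)) ℝ).comp (L.symm : 𝔼 (n + 1 + 1) →L[ℝ] 𝔼 (n + 1) × ℝ).toLinearMap)
    ((L : 𝔼 (n + 1) × ℝ →L[ℝ] 𝔼 (n + 1 + 1)).toLinearMap.comp (LinearMap.inl ℝ (𝔼 (n + 1)) ℝ))
    (fun v => ?_) (fun v hv => ?_) (fun u => ?_) (fun u => ?_)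
  · simp only [LinearMap.BilinMap.toQuadraticMap_apply, LinearMap.coe_comp, Function.comp_apply,
      ContinuousLinearMap.coe_coe, ContinuousLinearEquiv.coe_coe, LinearMap.fst_apply, key]
    nlinarith [sq_nonneg ((L.symm v).2)]
  · simp only [LinearMap.coe_comp, Function.comp_apply, ContinuousLinearMap.coe_coe,
      ContinuousLinearEquiv.coe_coe, LinearMap.fst_apply] at hv
    simp only [LinearMap.BilinMap.toQuadraticMap_apply, key, hv, map_zero, zero_add]
    nlinarith [sq_nonneg ((L.symm v).2)]
  · simp [LinearMap.BilinMap.toQuadraticMap_apply, key]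
  · simp

/-- `Crit(G) = {(w, 0) : w ∈ Crit(f)}` and indices correspond. [cite: Milnor1963, §2] -/
theorem mem_criticalSetOfIndex_thickFun_iff (hf : ContMDiff (𝓡∂ (n + 1)) 𝓘(ℝ, ℝ) ∞ f)
    (x : Ambient W L) (i : ℕ) :
    x ∈ criticalSetOfIndex (𝓡 (n + 1 + 1)) (thickFun L f) i ↔
      (pt L x).1 ∈ criticalSetOfIndex (𝓡∂ (n + 1)) f i ∧ (pt L x).2 = 0 := by
  simp only [mem_criticalSetOfIndex, isMCriticalPt_thickFun_iff L hf, morseIndex_thickFun L hf]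
  tauto

end MorseData

/-! ### The thickening `V = {G ≤ c}` as a compact manifold with boundary, with handle counts -/

section Thickening

variable {f : W → ℝ}

/-- **The thickened function of a Morse function is a Morse function** on the ambient
`Int W × ℝ`. [cite: Milnor1963, §2] -/
theorem isMorse_thickFun (hf : IsMorse (𝓡∂ (n + 1)) f) : IsMorse (𝓡 (n + 1 + 1)) (thickFun L f) := by
  refine ⟨contMDiff_thickFun L hf.1, fun x hx => ?_⟩
  rw [isMCriticalPt_thickFun_iff L hf.1] at hx
  exact nondegenerate_mhessian_thickFun L hf.1 (hf.2 _ hx.1)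

/-- A level `c` which is not a critical value of `f` is a regular level of the thickened
function. [cite: Milnor1963, Thm. 3.1] -/
theorem isRegularLevel_thickFun (hf : IsMorse (𝓡∂ (n + 1)) f) {c : ℝ}
    (hc : ∀ w, IsMCriticalPt (𝓡∂ (n + 1)) f w → f w ≠ c) :
    IsRegularLevel (𝓡 (n + 1 + 1)) (thickFun L f) c := by
  refine (isMorse_thickFun L hf).isRegularLevel fun x hx => ?_
  rw [isMCriticalPt_thickFun_iff L hf.1] at hx
  simp only [thickFun, hx.2]
  simpa using hc _ hx.1

/-- **The thickening** `V = {(w, s) : f w + s² ≤ c}` of the sublevel set `{f ≤ c}`, a regular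
sublevel set of the thickened function in the boundaryless ambient `Int W × ℝ`: a `C^∞` manifold
with boundary `{f w + s² = c}` modelled on `𝓡∂ (n + 2)` (`RegularSublevel`). [cite: Milnor1963, Thm. 3.1] -/
def Thickening (hf : IsMorse (𝓡∂ (n + 1)) f) {c : ℝ}
    (hc : ∀ w, IsMCriticalPt (𝓡∂ (n + 1)) f w → f w ≠ c) : Type u :=
  RegularSublevel (isRegularLevel_thickFun L hf hc)

variable (hf : IsMorse (𝓡∂ (n + 1)) f) {c : ℝ} (hc : ∀ w, IsMCriticalPt (𝓡∂ (n + 1)) f w → f w ≠ c)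

/-- The subspace topology on the thickening. [folklore] -/
instance : TopologicalSpace (Thickening L hf hc) := inferInstanceAs (TopologicalSpace (RegularSublevel _))
/-- **The thickening is a manifold with boundary, charts** (Milnor 1963, Thm. 3.1, via
`RegularSublevel`). [cite: Milnor1963, Thm. 3.1] -/
instance : ChartedSpace (EuclideanHalfSpace (n + 1 + 1)) (Thickening L hf hc) :=
  inferInstanceAs (ChartedSpace (EuclideanHalfSpace (n + 1 + 1)) (RegularSublevel _))
/-- **The thickening is a `C^∞` manifold with boundary** (Milnor 1963, Thm. 3.1, via
`RegularSublevel`). [cite: Milnor1963, Thm. 3.1] -/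
instance : IsManifold (𝓡∂ (n + 1 + 1)) ∞ (Thickening L hf hc) :=
  inferInstanceAs (IsManifold (𝓡∂ (n + 1 + 1)) ∞ (RegularSublevel _))
/-- The thickening of a Hausdorff `W` is Hausdorff. [folklore] -/
instance [T2Space W] : T2Space (Thickening L hf hc) := inferInstanceAs (T2Space (RegularSublevel _))
/-- The thickening of a second-countable `W` is second countable. [folklore] -/
instance [SecondCountableTopology W] : SecondCountableTopology (Thickening L hf hc) :=
  inferInstanceAs (SecondCountableTopology (RegularSublevel _))

namespace Thickening

/-- The inclusion of the thickening into the ambient. [folklore] -/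
def incl (x : Thickening L hf hc) : Ambient W L := RegularSublevel.incl _ x

/-- The underlying point `(w, s)` of `W × ℝ`. [folklore] -/
def base (x : Thickening L hf hc) : W × ℝ := pt L (incl L hf hc x)

/-- Points of the thickening satisfy `f w + s² ≤ c`. [folklore] -/
theorem thickFun_incl_le (x : Thickening L hf hc) : thickFun L f (incl L hf hc x) ≤ c :=
  RegularSublevel.apply_incl_le _ x

/-- Points of the thickening satisfy `f w + s² ≤ c` (in terms of `base`). [folklore] -/
theorem apply_base_le (x : Thickening L hf hc) : f (base L hf hc x).1 + (base L hf hc x).2 ^ 2 ≤ c :=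
  thickFun_incl_le L hf hc x

/-- `base : V → W × ℝ` is injective. [folklore] -/
theorem injective_base : Injective (base L hf hc) :=
  (injective_pt L).comp (RegularSublevel.injective_incl _)

/-- `base : V → W × ℝ` is continuous. [folklore] -/
theorem continuous_base : Continuous (base L hf hc) :=
  (contMDiff_pt L).continuous.comp (RegularSublevel.continuous_incl _)

/-- **The thickening of a compact sublevel set in the interior is compact**: `{f w + s² ≤ c}` is
a closed subset of `{f ≤ c} × [-R, R]` with `R² = c - min f`. [folklore] -/
theorem compactSpace [CompactSpace W] (hint : ∀ w, f w ≤ c → (𝓡∂ (n + 1)).IsInteriorPoint w) :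
    CompactSpace (Thickening L hf hc) := by
  -- the compact set `K ⊆ W × ℝ`
  obtain ⟨m, hm⟩ : ∃ m, ∀ w, m ≤ f w := by
    rcases isEmpty_or_nonempty W with hW | hW
    · exact ⟨0, fun w => (IsEmpty.false w).elim⟩
    · obtain ⟨w₀, -, hw₀⟩ := isCompact_univ.exists_isMinOn univ_nonempty
        (hf.1.continuous.continuousOn)
      exact ⟨f w₀, fun w => hw₀ (mem_univ w)⟩
  set R : ℝ := Real.sqrt (c - m) with hR
  set K : Set (W × ℝ) := {p | f p.1 + p.2 ^ 2 ≤ c} with hK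
  have hKc : IsCompact K := by
    have hsub : K ⊆ (univ : Set W) ×ˢ Icc (-R) R := by
      rintro ⟨w, s⟩ hp
      simp only [hK, mem_setOf_eq] at hp
      refine ⟨mem_univ _, ?_⟩
      have hs : s ^ 2 ≤ c - m := by linarith [hm w, hp]
      have hs' : |s| ≤ R := by
        rw [hR, ← Real.sqrt_sq_eq_abs]
        exact Real.sqrt_le_sqrt hs
      exact ⟨by linarith [neg_abs_le s, hs'], by linarith [le_abs_self s, hs']⟩
    refine (isCompact_univ.prod isCompact_Icc).of_isClosed_subset ?_ hsub
    exact isClosed_le ((hf.1.continuous.comp continuous_fst).add (continuous_snd.pow 2))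
      continuous_const
  -- `K` is the image of the sublevel set under the embedding `pt`
  have hrange : K ⊆ range (pt L : Ambient W L → W × ℝ) := by
    rintro ⟨w, s⟩ hp
    have hw : (𝓡∂ (n + 1)).IsInteriorPoint w := hint w (by
      simp only [hK, mem_setOf_eq] at hp; nlinarith [sq_nonneg s])
    have hws : (prodModel n).IsInteriorPoint (w, s) := by
      show (w, s) ∈ (prodModel n).interior (W × ℝ)
      rw [ModelWithCorners.interior_prod]
      exact ⟨hw, BoundarylessManifold.isInteriorPoint⟩
    exact ⟨Recharted.of L ⟨(w, s), hws⟩, rfl⟩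
  have hind : Topology.IsInducing (pt L : Ambient W L → W × ℝ) :=
    InteriorManifold.isInducing_val.comp (Recharted.ofHomeomorph L).symm.isInducing
  refine isCompact_iff_compactSpace.1 ((hind.isCompact_iff).2 ?_)
  have himage : (pt L : Ambient W L → W × ℝ) '' ((thickFun L f) ⁻¹' Iic c) = K := by
    apply Subset.antisymm
    · rintro _ ⟨x, hx, rfl⟩; exact hx
    · intro p hp
      obtain ⟨x, rfl⟩ := hrange hp
      exact ⟨x, hp, rfl⟩
  rw [himage]
  exact hKc

/-- **Handle counts of the thickening**: `V = {f + s² ≤ c}` has a handle decomposition with as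
many handles of index `i` as `f` has critical points of index `i` below `c` — the critical points
of `G = f + s²` are the `(w, 0)` with `w` critical for `f`, with the same index. [cite: FreedmanGompfMorrisonWalker2010, proof of Fact 2] -/
theorem hasHandleDecomposition (hint : ∀ w, f w ≤ c → (𝓡∂ (n + 1)).IsInteriorPoint w) :
    HasHandleDecomposition (n + 1) (Thickening L hf hc)
      fun i => (criticalSetOfIndex (𝓡∂ (n + 1)) f i ∩ f ⁻¹' Iic c).ncard := by
  show HasHandleDecomposition (n + 1) (RegularSublevel (isRegularLevel_thickFun L hf hc)) _
  have h := RegularSublevel.hasHandleDecomposition (isMorse_thickFun L hf) (isRegularLevel_thickFun L hf hc)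
  convert h using 2 with i
  symm
  refine Set.ncard_congr (fun x _ => (pt L x).1) (fun x hx => ?_) (fun x y hx hy hxy => ?_)
    (fun w hw => ?_)
  · obtain ⟨hx1, hx2⟩ := hx
    rw [mem_criticalSetOfIndex_thickFun_iff L hf.1] at hx1
    refine ⟨hx1.1, ?_⟩
    simp only [mem_preimage, mem_Iic, thickFun, hx1.2] at hx2 ⊢
    simpa using hx2
  · obtain ⟨hx1, -⟩ := hx
    obtain ⟨hy1, -⟩ := hy
    rw [mem_criticalSetOfIndex_thickFun_iff L hf.1] at hx1 hy1
    have hpt : pt L x = pt L y := Prod.ext hxy (by rw [hx1.2, hy1.2])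
    have : (Recharted.of L).symm x = (Recharted.of L).symm y := InteriorManifold.val_injective hpt
    simpa using this
  · obtain ⟨hw1, hw2⟩ := hw
    have hwi : (𝓡∂ (n + 1)).IsInteriorPoint w := hint w hw2
    have hws : (prodModel n).IsInteriorPoint (w, (0 : ℝ)) := by
      show (w, (0 : ℝ)) ∈ (prodModel n).interior (W × ℝ)
      rw [ModelWithCorners.interior_prod]
      exact ⟨hwi, BoundarylessManifold.isInteriorPoint⟩
    refine ⟨Recharted.of L ⟨(w, 0), hws⟩, ⟨?_, ?_⟩, rfl⟩
    · rw [mem_criticalSetOfIndex_thickFun_iff L hf.1]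
      exact ⟨hw1, rfl⟩
    · simp only [mem_preimage, mem_Iic, thickFun]
      show f w + (0 : ℝ) ^ 2 ≤ c
      simpa using hw2

/-- **The thickening of a `k`-handlebody piece is a `k`-handlebody**: if every critical point of
`f` below `c` has index `≤ k`, then `V = {f + s² ≤ c}` is a handlebody with handles of index
`≤ k`. [cite: FreedmanGompfMorrisonWalker2010, proof of Fact 2] -/
theorem isHandlebodyOfIndexLE {k : ℕ}
    (hk : ∀ w, IsMCriticalPt (𝓡∂ (n + 1)) f w → f w ≤ c → morseIndex (𝓡∂ (n + 1)) f w ≤ k) :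
    IsHandlebodyOfIndexLE (n + 1) k (Thickening L hf hc) := by
  show IsHandlebodyOfIndexLE (n + 1) k (RegularSublevel (isRegularLevel_thickFun L hf hc))
  obtain ⟨hadapt, hcrit, hind⟩ :=
    RegularSublevel.morseData (isMorse_thickFun L hf) (isRegularLevel_thickFun L hf hc)
  refine ⟨_, hadapt, fun x hx => ?_⟩
  have hx' := (hcrit x).1 hx
  rw [hind x hx', morseIndex_thickFun L hf.1]
  have hx'' := hx'
  rw [isMCriticalPt_thickFun_iff L hf.1] at hx''
  refine hk _ hx''.1 ?_
  have hle := RegularSublevel.apply_incl_le (isRegularLevel_thickFun L hf hc) x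
  simp only [thickFun, hx''.2] at hle
  simpa using hle

end Thickening

end Thickening

end DoubleThickening

end Literature.Topology.FourManifolds

end
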